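import Literature.Probability.Process.ExitTimeContinuityLocal
import HarnessLib

/-!
# Continuity of a stopped clock from lower semicontinuity and clean upper semicontinuity; minima of stopping functionals

Topic `Literature/Probability/Process`; theorems only. Abstraction of `ExitTimeContinuity(Local).lean`:
the LEVEL time of a boundary observable is the MINIMUM of finitely many exit times (one per mark
flow / gap), and the minimum of exit times is not itself an exit time of a path functional.  What
the clean-exit continuity argument really uses about a random time `τ : X → WithTop ℝ≥0` at a point
`x₀` are two one-sided properties:

* (LSC up to `b`)  `∀ v ≤ b, ↑v < τ x₀ → ∀ᶠ x, ↑v < τ x` — nearby points have not stopped by any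
  time strictly before `τ x₀` (inside the horizon `b` of uniform control);
* (clean USC)  `τ x₀ = ↑T → ∀ ε > 0, ∃ s, ↑s < T + ε ∧ ∀ᶠ x, τ x ≤ ↑s` — nearby points stop soon
  after `T`.

Both pass to minima (`lsc_min`; `usc_min_left/right`: clean USC of a component ATTAINING the
minimum suffices), exit times of uniformly-close path functionals have them
(`lsc_exitTime_comp`, `usc_exitTime_comp_of_clean`), and together they give continuity of the
stopped clock `x ↦ u ∧ τ x` (`continuousAt_untopA_min_of_lsc_usc`, for `u < b`;
`continuousAt_untopA_min_of_lsc_usc_of_lt`, for every `u` when `τ x₀ = ↑T` with `T < b`) and joint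
continuity in `(u, x)` (`continuousAt_stoppedClock_of_lsc_usc(_of_lt)`).

## References

* F. Camia, C. M. Newman, Probab. Theory Related Fields 139 (2007) 473–519, §5. [CamiaNewman2007]
* P. Billingsley, *Convergence of Probability Measures*, 2nd ed. (1999), §2. [Billingsley1999]
-/

noncomputable section

open MeasureTheory Filter Topology Set
open scoped NNReal ENNReal

namespace Literature.Probability.Process

section Abstract

variable {X : Type*} [TopologicalSpace X] {τ τ₁ τ₂ : X → WithTop ℝ≥0} {x₀ : X} {b : ℝ≥0}

/-! ### Minima -/

/-- Lower semicontinuity up to the horizon passes to the minimum of two random times. [folklore] -/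
theorem lsc_min
    (h₁ : ∀ v : ℝ≥0, v ≤ b → (v : WithTop ℝ≥0) < τ₁ x₀ → ∀ᶠ x in 𝓝 x₀, (v : WithTop ℝ≥0) < τ₁ x)
    (h₂ : ∀ v : ℝ≥0, v ≤ b → (v : WithTop ℝ≥0) < τ₂ x₀ → ∀ᶠ x in 𝓝 x₀, (v : WithTop ℝ≥0) < τ₂ x) :
    ∀ v : ℝ≥0, v ≤ b → (v : WithTop ℝ≥0) < min (τ₁ x₀) (τ₂ x₀) →
      ∀ᶠ x in 𝓝 x₀, (v : WithTop ℝ≥0) < min (τ₁ x) (τ₂ x) := by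
  intro v hv hlt
  filter_upwards [h₁ v hv (lt_min_iff.1 hlt).1, h₂ v hv (lt_min_iff.1 hlt).2] with x hx₁ hx₂
  exact lt_min hx₁ hx₂

/-- Clean upper semicontinuity of the minimum, from the LEFT component when it attains the minimum.
[folklore] -/
theorem usc_min_left (hle : τ₁ x₀ ≤ τ₂ x₀)
    (h₁ : ∀ T : ℝ≥0, τ₁ x₀ = T → ∀ ε : ℝ, 0 < ε →
      ∃ s : ℝ≥0, (s : ℝ) < T + ε ∧ ∀ᶠ x in 𝓝 x₀, τ₁ x ≤ s) :
    ∀ T : ℝ≥0, min (τ₁ x₀) (τ₂ x₀) = T → ∀ ε : ℝ, 0 < ε →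
      ∃ s : ℝ≥0, (s : ℝ) < T + ε ∧ ∀ᶠ x in 𝓝 x₀, min (τ₁ x) (τ₂ x) ≤ s := by
  intro T hT ε hε
  rw [min_eq_left hle] at hT
  obtain ⟨s, hs, hev⟩ := h₁ T hT ε hε
  exact ⟨s, hs, hev.mono fun x hx ↦ (min_le_left _ _).trans hx⟩

/-- Clean upper semicontinuity of the minimum, from the RIGHT component when it attains the minimum.
[folklore] -/
theorem usc_min_right (hle : τ₂ x₀ ≤ τ₁ x₀)
    (h₂ : ∀ T : ℝ≥0, τ₂ x₀ = T → ∀ ε : ℝ, 0 < ε →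
      ∃ s : ℝ≥0, (s : ℝ) < T + ε ∧ ∀ᶠ x in 𝓝 x₀, τ₂ x ≤ s) :
    ∀ T : ℝ≥0, min (τ₁ x₀) (τ₂ x₀) = T → ∀ ε : ℝ, 0 < ε →
      ∃ s : ℝ≥0, (s : ℝ) < T + ε ∧ ∀ᶠ x in 𝓝 x₀, min (τ₁ x) (τ₂ x) ≤ s := by
  intro T hT ε hε
  rw [min_eq_right hle] at hT
  obtain ⟨s, hs, hev⟩ := h₂ T hT ε hε
  exact ⟨s, hs, hev.mono fun x hx ↦ (min_le_right _ _).trans hx⟩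

/-! ### Continuity of the stopped clock -/

/-- **Continuity of the stopped clock `x ↦ u ∧ τ x` at `x₀` for `u < b`**, from lower
semicontinuity up to `b` and clean upper semicontinuity at `x₀`. [cite: Billingsley1999, §2] -/
theorem continuousAt_untopA_min_of_lsc_usc
    (hlsc : ∀ v : ℝ≥0, v ≤ b → (v : WithTop ℝ≥0) < τ x₀ → ∀ᶠ x in 𝓝 x₀, (v : WithTop ℝ≥0) < τ x)
    (husc : ∀ T : ℝ≥0, τ x₀ = T → ∀ ε : ℝ, 0 < ε →
      ∃ s : ℝ≥0, (s : ℝ) < T + ε ∧ ∀ᶠ x in 𝓝 x₀, τ x ≤ s)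
    {u : ℝ≥0} (hub : u < b) :
    ContinuousAt (fun x ↦ (min (u : WithTop ℝ≥0) (τ x)).untopA) x₀ := by
  set c : X → ℝ≥0 := fun x ↦ (min (u : WithTop ℝ≥0) (τ x)).untopA with hc
  rw [ContinuousAt, Metric.tendsto_nhds]
  intro ε hε
  have hcu : ∀ x, c x ≤ u := fun x ↦ untopA_min_coe_le u (τ x)
  -- LOWER bound
  have hlow : ∀ᶠ x in 𝓝 x₀, (c x₀ : ℝ) - ε < c x := by
    by_cases h0 : (c x₀ : ℝ) - ε < 0
    · exact Eventually.of_forall fun x ↦ h0.trans_le (c x).coe_nonneg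
    · rw [not_lt] at h0
      set v : ℝ≥0 := ⟨(c x₀ : ℝ) - ε / 2, by linarith⟩ with hv
      have hvc : v < c x₀ := by
        rw [← NNReal.coe_lt_coe]
        show (c x₀ : ℝ) - ε / 2 < c x₀
        linarith
      have hvu : v ≤ u := hvc.le.trans (hcu x₀)
      have hvτ : (v : WithTop ℝ≥0) < τ x₀ :=
        lt_of_lt_of_le (WithTop.coe_lt_coe.2 hvc) ((coe_untopA_min u (τ x₀)).le.trans
          (min_le_right _ _))
      filter_upwards [hlsc v (hvu.trans hub.le) hvτ] with x hx
      have : v ≤ c x := le_untopA_min_coe_of_coe_lt hvu hx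
      have hv' : (v : ℝ) = c x₀ - ε / 2 := rfl
      calc (c x₀ : ℝ) - ε < c x₀ - ε / 2 := by linarith
        _ = v := hv'.symm
        _ ≤ c x := NNReal.coe_le_coe.2 this
  -- UPPER bound
  have hup : ∀ᶠ x in 𝓝 x₀, (c x : ℝ) < c x₀ + ε := by
    rcases lt_or_ge ((u : WithTop ℝ≥0)) (τ x₀) with hlt | hge
    · have hcu₀ : c x₀ = u := by
        show (min (u : WithTop ℝ≥0) (τ x₀)).untopA = u
        rw [min_eq_left hlt.le]; rfl
      refine Eventually.of_forall fun x ↦ ?_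
      rw [hcu₀]
      have := NNReal.coe_le_coe.2 (hcu x)
      linarith
    · obtain ⟨T, hT⟩ := WithTop.ne_top_iff_exists.1 (ne_top_of_le_ne_top WithTop.coe_ne_top hge)
      have hcT : c x₀ = T := by
        show (min (u : WithTop ℝ≥0) (τ x₀)).untopA = T
        rw [min_eq_right hge, ← hT]; rfl
      obtain ⟨s, hsε, hev⟩ := husc T hT.symm ε hε
      filter_upwards [hev] with x hx
      have h1 : c x ≤ s := untopA_min_coe_le_of_le_coe u hx
      calc (c x : ℝ) ≤ s := NNReal.coe_le_coe.2 h1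
        _ < T + ε := hsε
        _ = c x₀ + ε := by rw [hcT]
  filter_upwards [hlow, hup] with x h1 h2
  rw [NNReal.dist_eq]
  exact abs_sub_lt_iff.2 ⟨by linarith, by linarith⟩

/-- **Continuity of the stopped clock at EVERY observation time**, when `τ x₀ = ↑T` is finite with
`T < b`: for `u ≥ b` the clock agrees near `x₀` with the clock observed at a time in `(T, b)`.
[cite: Billingsley1999, §2] -/
theorem continuousAt_untopA_min_of_lsc_usc_of_lt
    (hlsc : ∀ v : ℝ≥0, v ≤ b → (v : WithTop ℝ≥0) < τ x₀ → ∀ᶠ x in 𝓝 x₀, (v : WithTop ℝ≥0) < τ x)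
    (husc : ∀ T : ℝ≥0, τ x₀ = T → ∀ ε : ℝ, 0 < ε →
      ∃ s : ℝ≥0, (s : ℝ) < T + ε ∧ ∀ᶠ x in 𝓝 x₀, τ x ≤ s)
    {T : ℝ≥0} (hT : τ x₀ = T) (hTb : T < b) (u : ℝ≥0) :
    ContinuousAt (fun x ↦ (min (u : WithTop ℝ≥0) (τ x)).untopA) x₀ := by
  rcases lt_or_ge u b with hub | hbu
  · exact continuousAt_untopA_min_of_lsc_usc hlsc husc hub
  · set u' : ℝ≥0 := ⟨((T : ℝ) + b) / 2, by positivity⟩ with hu'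
    have hTb' : (T : ℝ) < b := NNReal.coe_lt_coe.2 hTb
    have hTu' : T < u' := by
      rw [← NNReal.coe_lt_coe]; show (T : ℝ) < ((T : ℝ) + b) / 2; linarith
    have hu'b : u' < b := by
      rw [← NNReal.coe_lt_coe]; show ((T : ℝ) + b) / 2 < b; linarith
    have hu'u : u' ≤ u := hu'b.le.trans hbu
    obtain ⟨s, hsu', hev⟩ := husc T hT ((u' : ℝ) - T) (by
      have := NNReal.coe_lt_coe.2 hTu'; linarith)
    have hsu'' : s ≤ u' := by
      rw [← NNReal.coe_le_coe]; linarith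
    have hev' : ∀ᶠ x in 𝓝 x₀, (min (u : WithTop ℝ≥0) (τ x)).untopA =
        (min (u' : WithTop ℝ≥0) (τ x)).untopA := by
      filter_upwards [hev] with x hx
      have hτu' : τ x ≤ (u' : WithTop ℝ≥0) := hx.trans (WithTop.coe_le_coe.2 hsu'')
      have hτu : τ x ≤ (u : WithTop ℝ≥0) := hτu'.trans (WithTop.coe_le_coe.2 hu'u)
      rw [min_eq_right hτu, min_eq_right hτu']
    exact (continuousAt_untopA_min_of_lsc_usc hlsc husc hu'b).congr_of_eventuallyEq hev'

/-- **Joint continuity of the stopped clock `(u, x) ↦ u ∧ τ x` at `(u₀, x₀)` for `u₀ < b`.**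
[folklore] -/
theorem continuousAt_stoppedClock_of_lsc_usc
    (hlsc : ∀ v : ℝ≥0, v ≤ b → (v : WithTop ℝ≥0) < τ x₀ → ∀ᶠ x in 𝓝 x₀, (v : WithTop ℝ≥0) < τ x)
    (husc : ∀ T : ℝ≥0, τ x₀ = T → ∀ ε : ℝ, 0 < ε →
      ∃ s : ℝ≥0, (s : ℝ) < T + ε ∧ ∀ᶠ x in 𝓝 x₀, τ x ≤ s)
    {u₀ : ℝ≥0} (hub : u₀ < b) :
    ContinuousAt (fun q : ℝ≥0 × X ↦ (min (q.1 : WithTop ℝ≥0) (τ q.2)).untopA) (u₀, x₀) := by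
  rw [ContinuousAt, Metric.tendsto_nhds]
  intro ε hε
  have h2 : ∀ᶠ x in 𝓝 x₀, dist (min (u₀ : WithTop ℝ≥0) (τ x)).untopA
      (min (u₀ : WithTop ℝ≥0) (τ x₀)).untopA < ε / 2 :=
    Metric.tendsto_nhds.1 (continuousAt_untopA_min_of_lsc_usc hlsc husc hub) (ε / 2) (half_pos hε)
  have h1 : ∀ᶠ v in 𝓝 u₀, dist v u₀ < ε / 2 := Metric.ball_mem_nhds u₀ (half_pos hε)
  filter_upwards [h1.prod_nhds h2] with q hq
  obtain ⟨hq1, hq2⟩ := hq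
  calc dist (min (q.1 : WithTop ℝ≥0) (τ q.2)).untopA (min (u₀ : WithTop ℝ≥0) (τ x₀)).untopA
      ≤ dist (min (q.1 : WithTop ℝ≥0) (τ q.2)).untopA (min (u₀ : WithTop ℝ≥0) (τ q.2)).untopA +
          dist (min (u₀ : WithTop ℝ≥0) (τ q.2)).untopA (min (u₀ : WithTop ℝ≥0) (τ x₀)).untopA :=
        dist_triangle _ _ _
    _ < ε / 2 + ε / 2 := add_lt_add_of_le_of_lt
        ((dist_untopA_min_coe_le (τ q.2) u₀ q.1).trans hq1.le) hq2
    _ = ε := add_halves ε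

/-- **Joint continuity of the stopped clock at `(u₀, x₀)` for EVERY `u₀`**, when `τ x₀ = ↑T` with
`T < b`. [folklore] -/
theorem continuousAt_stoppedClock_of_lsc_usc_of_lt
    (hlsc : ∀ v : ℝ≥0, v ≤ b → (v : WithTop ℝ≥0) < τ x₀ → ∀ᶠ x in 𝓝 x₀, (v : WithTop ℝ≥0) < τ x)
    (husc : ∀ T : ℝ≥0, τ x₀ = T → ∀ ε : ℝ, 0 < ε →
      ∃ s : ℝ≥0, (s : ℝ) < T + ε ∧ ∀ᶠ x in 𝓝 x₀, τ x ≤ s)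
    {T : ℝ≥0} (hT : τ x₀ = T) (hTb : T < b) (u₀ : ℝ≥0) :
    ContinuousAt (fun q : ℝ≥0 × X ↦ (min (q.1 : WithTop ℝ≥0) (τ q.2)).untopA) (u₀, x₀) := by
  rw [ContinuousAt, Metric.tendsto_nhds]
  intro ε hε
  have h2 : ∀ᶠ x in 𝓝 x₀, dist (min (u₀ : WithTop ℝ≥0) (τ x)).untopA
      (min (u₀ : WithTop ℝ≥0) (τ x₀)).untopA < ε / 2 :=
    Metric.tendsto_nhds.1 (continuousAt_untopA_min_of_lsc_usc_of_lt hlsc husc hT hTb u₀) (ε / 2)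
      (half_pos hε)
  have h1 : ∀ᶠ v in 𝓝 u₀, dist v u₀ < ε / 2 := Metric.ball_mem_nhds u₀ (half_pos hε)
  filter_upwards [h1.prod_nhds h2] with q hq
  obtain ⟨hq1, hq2⟩ := hq
  calc dist (min (q.1 : WithTop ℝ≥0) (τ q.2)).untopA (min (u₀ : WithTop ℝ≥0) (τ x₀)).untopA
      ≤ dist (min (q.1 : WithTop ℝ≥0) (τ q.2)).untopA (min (u₀ : WithTop ℝ≥0) (τ q.2)).untopA +
          dist (min (u₀ : WithTop ℝ≥0) (τ q.2)).untopA (min (u₀ : WithTop ℝ≥0) (τ x₀)).untopA :=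
        dist_triangle _ _ _
    _ < ε / 2 + ε / 2 := add_lt_add_of_le_of_lt
        ((dist_untopA_min_coe_le (τ q.2) u₀ q.1).trans hq1.le) hq2
    _ = ε := add_halves ε

end Abstract

/-! ### Exit times of uniformly close path functionals -/

section ExitTimes

variable {X : Type*} [TopologicalSpace X] {Φ : X → C(ℝ≥0, ℝ)} {x₀ : X} {b : ℝ≥0} {a a' : ℝ}

/-- **Exit times of a uniformly close path functional are lower semicontinuous up to the horizon.**
[folklore] -/
theorem lsc_exitTime_comp
    (hunif : ∀ ε : ℝ, 0 < ε → ∀ᶠ x in 𝓝 x₀, ∀ s : ℝ≥0, s ≤ b → |Φ x s - Φ x₀ s| < ε) :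
    ∀ v : ℝ≥0, v ≤ b →
      (v : WithTop ℝ≥0) < exitTime (fun t (p : C(ℝ≥0, ℝ)) ↦ p t) a a' (Φ x₀) →
      ∀ᶠ x in 𝓝 x₀, (v : WithTop ℝ≥0) < exitTime (fun t (p : C(ℝ≥0, ℝ)) ↦ p t) a a' (Φ x) :=
  fun _ hv hvτ ↦ eventually_coe_lt_exitTime_comp hunif hv hvτ

/-- **A clean finite exit inside the horizon gives clean upper semicontinuity.** [folklore] -/
theorem usc_exitTime_comp_of_clean
    (hunif : ∀ ε : ℝ, 0 < ε → ∀ᶠ x in 𝓝 x₀, ∀ s : ℝ≥0, s ≤ b → |Φ x s - Φ x₀ s| < ε)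
    (hτb : exitTime (fun t (p : C(ℝ≥0, ℝ)) ↦ p t) a a' (Φ x₀) < b)
    (hclean : ∀ T : ℝ≥0, exitTime (fun t (p : C(ℝ≥0, ℝ)) ↦ p t) a a' (Φ x₀) = T →
      ∀ ε : ℝ, 0 < ε → ∃ s : ℝ≥0, T < s ∧ (s : ℝ) < T + ε ∧ Φ x₀ s ∉ Icc a a') :
    ∀ T : ℝ≥0, exitTime (fun t (p : C(ℝ≥0, ℝ)) ↦ p t) a a' (Φ x₀) = T → ∀ ε : ℝ, 0 < ε →
      ∃ s : ℝ≥0, (s : ℝ) < T + ε ∧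
        ∀ᶠ x in 𝓝 x₀, exitTime (fun t (p : C(ℝ≥0, ℝ)) ↦ p t) a a' (Φ x) ≤ s := by
  intro T hT ε hε
  have hTb : T < b := by
    have := hτb; rw [hT] at this; exact WithTop.coe_lt_coe.1 this
  set ε' : ℝ := min ε ((b : ℝ) - T) with hε'
  have hε'pos : 0 < ε' := lt_min hε (by have := NNReal.coe_lt_coe.2 hTb; linarith)
  obtain ⟨s, -, hsε, hs⟩ := hclean T hT ε' hε'pos
  have hsb : s ≤ b := by
    rw [← NNReal.coe_le_coe]
    have h1 : ε' ≤ (b : ℝ) - T := min_le_right _ _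
    linarith
  refine ⟨s, lt_of_lt_of_le hsε (by linarith [min_le_left ε ((b : ℝ) - T)]), ?_⟩
  exact eventually_exitTime_comp_le hunif hsb hs

end ExitTimes

end Literature.Probability.Process

end
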